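import Summits.AtomisticToContinuum.Crystallization.Theorems.FrustratedLawDichotomyCellF1Host
import Summits.AtomisticToContinuum.Crystallization.Theorems.FrustratedLawDichotomyCellF1cLabels

/-!
# FrustratedLawDichotomy · crux `AperiodicFrustratedLawGap` (stmt-AtomisticToContinuum-27623) — class-A K-file tower, layer 2c-c:
WINDOW COMPLETENESS and the MIRROR HOST hypotheses over the COMPLETE template `MF1c` (KFILE amendment E2/E4, critic r1861; decomp-a2c hand-2 g48)

#88 `…CellF1Host` RE-BASED on #106 `MF1c`.  The complete template pays off here: the window-completeness radius becomes
`RwF1c = 13313/1024 = Rc + τ` EXACTLY (`RwF1c²·2²⁸ ≤ (1 − 3ε)(BLc + 1)`, one `norm_num`; #88's `MF1` only afforded `13271/1024 ≈ 12.96`), i.e. under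
every strain of the cell every parity site NOT in `MF1c` sits at distance `≥ Rc + τ` from the root — the mirror host core of every interior label is complete
out to the window.  Contents (hand-1 `…CellHostMirror` generic lemmas, instantiated): `offMc_qk`, `RwF1c_check`, `hfar_F1c`, ★ `hout_F1c`, `hadm_F1c`,
`hrev_F1c`, ★ `hnbh_F1c` (the (251) `hnbh` hypothesis verbatim for `nbh := mirrorNbh MF1c mirT` over `MIF1`, from any dial with `Lh m + ‖a_F m‖ ≤ RwF1c`).
Imports TREE #88 `…CellF1Host` + #106 `…CellF1cLabels`; 0 sorry.  Tags: [new: K-file layer]; nothing here closes an item.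
-/

namespace Summit.AtomisticToContinuum.Crystallization.Theorems.FrustratedLawDichotomyCellF1cHost

open scoped BigOperators
open Summit.AtomisticToContinuum.Crystallization.Theorems.FrustratedLawDichotomyCellMetric (posL)
open Summit.AtomisticToContinuum.Crystallization.Theorems.FrustratedLawDichotomyCellTriples (zT sumT)
open Summit.AtomisticToContinuum.Crystallization.Theorems.FrustratedLawDichotomyCellHostMirror
  (mirrorNbh mirT even_sumT_mirT posL_linTemplate_mirT hout_of_nearId hfar_of_intWindow hnbh_of_window)
open Summit.AtomisticToContinuum.Crystallization.Theorems.FrustratedLawDichotomyCellF1Frame (T qk sumSq_T)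
open Summit.AtomisticToContinuum.Crystallization.Theorems.FrustratedLawDichotomyCellF1Labels (MIF1)
open Summit.AtomisticToContinuum.Crystallization.Theorems.FrustratedLawDichotomyCellF1cLabels (MF1c BLc admLc admLc_iff mem_Mc MI_subset_Mc hparc)

/-- ★ the window-completeness radius of the COMPLETE F1 cell: `13313/1024 = Rc + τ = 13.0009765625`. -/
noncomputable def RwF1c : ℝ := 13313 / 1024

/-- `RwF1c` IS `Rc + τ`. -/
theorem RwF1c_eq : RwF1c = 13 + 1 / 1024 := by unfold RwF1c; norm_num

/-- a parity label off `MF1c` has class key at least `BLc + 1` (membership by predicate). -/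
theorem offMc_qk : ∀ x : ℤ × ℤ × ℤ, Even (sumT x) → x ∉ MF1c → BLc + 1 ≤ qk x := by
  intro x hx hxM
  by_contra hlt
  exact hxM (mem_Mc.mpr ((admLc_iff x).mpr ⟨hx, by omega⟩))

/-- the one rational check: `RwF1c²·2²⁸ ≤ (1 − 3ε)(BLc + 1)`. -/
theorem RwF1c_check : RwF1c ^ 2 * (16384 : ℝ) ^ 2 ≤ (1 - 3 * (1 / 1024 : ℝ)) * ((BLc : ℝ) + 1) := by
  unfold RwF1c BLc; norm_num

/-- the template form of completeness: off `MF1c`, `RwF1c² ≤ (1 − 3ε)·Σᵢ (T·z)ᵢ²`. -/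
theorem hfar_F1c : ∀ x : ℤ × ℤ × ℤ, Even (sumT x) → x ∉ MF1c →
    RwF1c ^ 2 ≤ (1 - 3 * (1 / 1024 : ℝ)) * ∑ i, (T.mulVec (fun j => (zT x j : ℝ)) i) ^ 2 :=
  hfar_of_intWindow (M := MF1c) (adm := fun x : ℤ × ℤ × ℤ => Even (sumT x)) (a := fun x => T.mulVec fun j => (zT x j : ℝ))
    (q := qk) (D := 16384) (by norm_num) sumSq_T (by norm_num) RwF1c_check offMc_qk

/-- ★ WINDOW COMPLETENESS of the complete F1 cell: under every `F` of the strain cell, a parity label NOT in `MF1c` is placed at distance `≥ Rc + τ` from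
the root. -/
theorem hout_F1c {F : Matrix (Fin 3) (Fin 3) ℝ} (hG : ∀ i j, |(F.transpose * F) i j - (if i = j then 1 else 0)| ≤ 1 / 1024) :
    ∀ x : ℤ × ℤ × ℤ, Even (sumT x) → x ∉ MF1c → RwF1c ≤ ‖posL F (T.mulVec fun j => (zT x j : ℝ))‖ :=
  hout_of_nearId hG hfar_F1c

/-- the mirror image `2m − m'` of a complete label `m'` in an interior label `m` is a parity label. -/
theorem hadm_F1c : ∀ m ∈ MIF1, ∀ m' ∈ MF1c, Even (sumT (mirT m m')) :=
  fun m _ m' hm' => even_sumT_mirT m (hparc m' hm')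

/-- bond reversal of the linear template under the label mirror (binders over `MIF1 × MF1c`). -/
theorem hrev_F1c (F : Matrix (Fin 3) (Fin 3) ℝ) : ∀ m ∈ MIF1, ∀ m' ∈ MF1c,
    posL F (T.mulVec fun i => (zT m i : ℝ)) - posL F (T.mulVec fun i => (zT (mirT m m') i : ℝ))
      = -(posL F (T.mulVec fun i => (zT m i : ℝ)) - posL F (T.mulVec fun i => (zT m' i : ℝ))) :=
  fun m _ m' _ => posL_linTemplate_mirT F T m m'

/-- ★ the (251) `hnbh` HYPOTHESIS for the complete F1 cell with `nbh := mirrorNbh MF1c mirT`, from any per-label dial `Lh` with `Lh m + ‖a_F m‖ ≤ RwF1c`: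
every complete label off the mirror core of an interior label `m` is at distance `≥ Lh m` from it. -/
theorem hnbh_F1c {F : Matrix (Fin 3) (Fin 3) ℝ} (hG : ∀ i j, |(F.transpose * F) i j - (if i = j then 1 else 0)| ≤ 1 / 1024)
    {Lh : ℤ × ℤ × ℤ → ℝ} (hLw : ∀ m ∈ MIF1, Lh m + ‖posL F (T.mulVec fun j => (zT m j : ℝ))‖ ≤ RwF1c) :
    ∀ m ∈ MIF1, ∀ m' ∈ MF1c, m' ≠ m → m' ∉ mirrorNbh MF1c mirT m →
      Lh m ≤ dist (posL F (T.mulVec fun j => (zT m' j : ℝ))) (posL F (T.mulVec fun j => (zT m j : ℝ))) :=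
  hnbh_of_window (MI := MIF1) (pos := fun x => posL F (T.mulVec fun j => (zT x j : ℝ))) (mir := mirT)
    (hout_F1c hG) hadm_F1c (hrev_F1c F) hLw

end Summit.AtomisticToContinuum.Crystallization.Theorems.FrustratedLawDichotomyCellF1cHost
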